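import Mathlib
import HarnessLib
import Literature.MathematicalPhysics.StatisticalMechanics.GradientFieldNorms
import Literature.MathematicalPhysics.StatisticalMechanics.TaylorPolynomialNormsTwoNorm

/-!
# The two-norm estimate between consecutive scales of the lattice field gauges
# (Adams–Buchholz–Kotecký–Müller, Lemma 8.1 (8.3))

[ABKM19] Lemma 8.1, second inequality: for a functional `F` measurable with respect to the gradients
near a polymer `X`,

`|F|_{k+1,X,T_φ} ≤ (1 + |φ|_{k+1,X})³ ( |F|_{k+1,X,T_0} + 16 L^{-3d/2} sup_{0≤t≤1} |F|_{k,X,T_{tφ}} )`,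

"the two norm estimate (13.22) in Proposition 13.11 with the norms `|g|_{k,X}` and `|g|_{k+1,X}` and
`r̃ = 2` … `ρ^{(3)} ≤ 16 L^{-3d/2}`".  Here: the instance of the abstract two-norm estimate
`tayNorm_two_gauge_le` (`TaylorPolynomialNormsTwoNorm.lean`) for two lattice field gauges
`T = fieldGauge 𝔥 R p S` (scale `k`) and `T' = fieldGauge 𝔥' R' p S` (scale `k+1`) on the same site
set, which are comparable with the constant `ρ = (𝔥'/𝔥)(R/R')` (`norm_fieldGauge_le_mul`; for
[ABKM19]'s weights `𝔥' = 2L^{-(d-2)/2}𝔥`, `R' = LR`, so `ρ = 2L^{-d/2}` and `2ρ³ = 16L^{-3d/2}`):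

* `tayNorm_fieldGauge_two_scale_le` — for `0 < 𝔥, 𝔥'`, `0 < R ≤ R'`, `ρ = (𝔥'/𝔥)(R/R') ≤ 1`, `F`
  `T`-local and `C^{r₀}`, `m < r₀` and `sup_ψ ‖F‖^{(T)}_{T_ψ} ≤ F_∞`:
  `‖F‖^{(T')}_{T_φ} ≤ (1 + ‖T'φ‖)^{m+1} ( ‖F‖^{(T')}_{T_0} + 2ρ^{m+1} F_∞ )`
  (the supremum over ALL fields `ψ` dominates the source's `sup_{t∈[0,1]} |F|_{k,X,T_{tφ}}`).

Everything is proved; no named fact.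

## References
* S. Adams, S. Buchholz, R. Kotecký, S. Müller, arXiv:1910.13564, Lemma 8.1 (8.3), Proposition 13.11
  [AdamsBuchholzKoteckyMuller2019].
-/

noncomputable section

namespace Literature.MathematicalPhysics.StatisticalMechanics.GradientRG

variable {d M : ℕ} [NeZero M] {𝔸 : Type*} [NormedRing 𝔸] [NormedAlgebra ℝ 𝔸] [CompleteSpace 𝔸]

/-- **Two-norm estimate between consecutive scales** ([ABKM19] Lemma 8.1 (8.3)): with
`T = fieldGauge 𝔥 R p S`, `T' = fieldGauge 𝔥' R' p S`, `0 < 𝔥, 𝔥'`, `0 < R ≤ R'` and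
`ρ = (𝔥'/𝔥)(R/R') ≤ 1`, every `T`-local `C^{r₀}` functional `F` with `sup_ψ ‖F‖^{(T)}_{T_ψ} ≤ F_∞`
satisfies, for `m < r₀`,
`‖F‖^{(T')}_{T_φ} ≤ (1 + ‖T'φ‖)^{m+1} (‖F‖^{(T')}_{T_0} + 2 ρ^{m+1} F_∞)`.
[cite: AdamsBuchholzKoteckyMuller2019, Lemma 8.1 (8.3)] -/
theorem tayNorm_fieldGauge_two_scale_le {𝔥 𝔥' R R' : ℝ} (h𝔥 : 0 < 𝔥) (h𝔥' : 0 < 𝔥')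
    (hR : 0 < R) (hRR' : R ≤ R') (hρ1 : 𝔥' / 𝔥 * (R / R') ≤ 1) (p : ℕ)
    (S : Finset (Fin d → ZMod M)) {r₀ m : ℕ} (hm : m < r₀) {F : ((Fin d → ZMod M) → ℝ) → 𝔸}
    (hF : ContDiff ℝ r₀ F) (hloc : IsGaugeLocal (fieldGauge 𝔥 R p S) F) {Fsup : ℝ}
    (hFsup : ∀ ψ, tayNorm (fieldGauge 𝔥 R p S) r₀ F ψ ≤ Fsup) (φ : (Fin d → ZMod M) → ℝ) :
    tayNorm (fieldGauge 𝔥' R' p S) r₀ F φ ≤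
      (1 + ‖fieldGauge 𝔥' R' p S φ‖) ^ (m + 1) *
        (tayNorm (fieldGauge 𝔥' R' p S) r₀ F 0 + 2 * (𝔥' / 𝔥 * (R / R')) ^ (m + 1) * Fsup) := by
  have hR' : 0 < R' := hR.trans_le hRR'
  exact tayNorm_two_gauge_le (fieldGauge 𝔥 R p S) (fieldGauge 𝔥' R' p S)
    (mul_pos (div_pos h𝔥' h𝔥) (div_pos hR hR')) hρ1
    (fun ξ => norm_fieldGauge_le_mul h𝔥 h𝔥' hR hRR' p S ξ) hm hF hloc hFsup φ

/-- The consecutive-scale constant of [ABKM19]: with `𝔥' = 2 L^{-(d-2)/2} 𝔥`... in the simplest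
bookkeeping `𝔥' = a 𝔥`, `R' = L R` the comparison constant is `ρ = a / L`
(`a = 2L^{-(d-2)/2}` gives `ρ = 2L^{-d/2}`). [cite: AdamsBuchholzKoteckyMuller2019, Lemma 8.1 (proof: ρ^{(3)} ≤ 16 L^{-3d/2})] -/
theorem two_scale_ratio {𝔥 R a L : ℝ} (h𝔥 : 0 < 𝔥) (hR : 0 < R) (hL : 0 < L) :
    a * 𝔥 / 𝔥 * (R / (L * R)) = a / L := by
  field_simp

end Literature.MathematicalPhysics.StatisticalMechanics.GradientRG

end
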